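import Mathlib
import Summits.AnomalousDissipation.AnomalousDissipation.Theorems.SoloBlindDiscreteLG

/-!
# SoloBlind — finite-horizon Volterra representation and inequality ([O1], PLAN §119.12)

For `w = P (1 + ε)` solving `w (k+2) = β (k+1) w (k+1) - w k`, normalised at the horizon by `ε N = ε (N+1) = 0`
(the comparison solution seeded on the LG ansatz at depth `N`, as the certified engine does), and `P` non-vanishing:

* `volterra_repr` — `ε k = - ∑_{j ∈ [k, N)} P (j+1) r (j+1) (1 + ε (j+1)) · ∑_{i ∈ [k, j]} 1 / (P i P (i+1))`
  (`r` = one-step residual of `P`), obtained from the telescoping identity and an exchange of the triangular double sum;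
* `volterra_ineq` — if the inner sums obey `‖P (j+1) ^ 2 · ∑_{i ∈ [k, j]} 1/(P i P (i+1))‖ ≤ B j` uniformly in `k ≤ j`
  (Lemma A: Abel bound) then `‖ε k‖ ≤ ∑_{j ∈ [k, N)} (‖r (j+1)‖ / ‖P (j+1)‖ · B j) (1 + ‖ε (j+1)‖)`, which is the
  hypothesis of the backward Gronwall lemma (`SoloBlindBackwardGronwall`) after the index shift `j ↦ j+1`.
-/

namespace Summit.AnomalousDissipation.SoloBlind.VolterraRepr

open Finset

/-- `D k = ∑_{j ∈ [k, N)} X j` when `D N = 0`, where `D k = P k P (k+1) (ε (k+1) - ε k)` and `X j = P (j+1) r (j+1) (1 + ε (j+1))`. -/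
theorem D_eq_sum (w P ε β r : ℕ → ℂ)
    (hw : ∀ k, w k = P k * (1 + ε k))
    (hrec : ∀ k, w (k + 2) = β (k + 1) * w (k + 1) - w k)
    (hr : ∀ k, r (k + 1) = P (k + 2) - β (k + 1) * P (k + 1) + P k)
    (N : ℕ) (hN : ε N = 0) (hN1 : ε (N + 1) = 0) :
    ∀ k, k ≤ N → P k * P (k + 1) * (ε (k + 1) - ε k) = ∑ j ∈ Ico k N, P (j + 1) * r (j + 1) * (1 + ε (j + 1)) := by
  suffices hs : ∀ d k, k + d = N →
      P k * P (k + 1) * (ε (k + 1) - ε k) = ∑ j ∈ Ico k N, P (j + 1) * r (j + 1) * (1 + ε (j + 1)) by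
    intro k hk; exact hs (N - k) k (by omega)
  intro d
  induction d with
  | zero =>
    intro k hk
    have hkN : k = N := by omega
    subst hkN
    rw [hN, hN1]; simp
  | succ d ih =>
    intro k hk
    have h1 := ih (k + 1) (by omega)
    have hs := Summit.AnomalousDissipation.SoloBlind.DiscreteLG.volterra_step w P ε β r hw hrec hr k
    rw [Finset.sum_eq_sum_Ico_succ_bot (by omega : k < N), ← h1]
    linear_combination (-1 : ℂ) * hs

/-- Finite-horizon Volterra representation of the relative error. -/
theorem volterra_repr (w P ε β r : ℕ → ℂ)
    (hw : ∀ k, w k = P k * (1 + ε k))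
    (hrec : ∀ k, w (k + 2) = β (k + 1) * w (k + 1) - w k)
    (hr : ∀ k, r (k + 1) = P (k + 2) - β (k + 1) * P (k + 1) + P k)
    (hP : ∀ k, P k ≠ 0) (N : ℕ) (hN : ε N = 0) (hN1 : ε (N + 1) = 0) (k : ℕ) (hk : k ≤ N) :
    ε k = - ∑ j ∈ Ico k N, (P (j + 1) * r (j + 1) * (1 + ε (j + 1))) *
              ∑ i ∈ Icc k j, 1 / (P i * P (i + 1)) := by
  set X : ℕ → ℂ := fun j => P (j + 1) * r (j + 1) * (1 + ε (j + 1)) with hX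
  -- (1) telescoping of ε
  have htel : ∑ i ∈ Ico k N, (ε (i + 1) - ε i) = ε N - ε k := by
    rw [Finset.sum_Ico_eq_sum_range]
    have h := Finset.sum_range_sub (fun i => ε (k + i)) (N - k)
    have hNk : k + (N - k) = N := by omega
    simp only [hNk, add_zero] at h
    rw [← h]
    refine Finset.sum_congr rfl (fun i _ => ?_)
    rw [show k + (i + 1) = k + i + 1 from by omega]
  -- (2) each increment is D i / (P i P (i+1))
  have hinc : ∀ i, i ∈ Ico k N → ε (i + 1) - ε i = (∑ j ∈ Ico i N, X j) / (P i * P (i + 1)) := by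
    intro i hi
    rw [mem_Ico] at hi
    have hD := D_eq_sum w P ε β r hw hrec hr N hN hN1 i (by omega)
    have hPP : P i * P (i + 1) ≠ 0 := mul_ne_zero (hP i) (hP (i + 1))
    rw [eq_div_iff hPP, ← hD]
    ring
  -- (3) assemble and exchange the triangular double sum
  have hsum : ε N - ε k = ∑ j ∈ Ico k N, X j * ∑ i ∈ Icc k j, 1 / (P i * P (i + 1)) := by
    rw [← htel, Finset.sum_congr rfl hinc]
    have hrew : ∀ i ∈ Ico k N, (∑ j ∈ Ico i N, X j) / (P i * P (i + 1))
        = ∑ j ∈ Ico i N, X j * (1 / (P i * P (i + 1))) := by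
      intro i _
      rw [Finset.sum_div]
      refine Finset.sum_congr rfl (fun j _ => ?_)
      ring
    rw [Finset.sum_congr rfl hrew]
    rw [Finset.sum_comm' (s := Ico k N) (t := fun i => Ico i N) (t' := Ico k N) (s' := fun j => Icc k j)]
    · refine Finset.sum_congr rfl (fun j _ => ?_)
      rw [Finset.mul_sum]
    · intro i j
      simp only [mem_Ico, mem_Icc]
      omega
  rw [hN] at hsum
  have : ε k = -(ε N - ε k) + ε N := by ring
  rw [hN] at this
  linear_combination (-1 : ℂ) * hsum

/-- The Volterra inequality that feeds the backward Gronwall lemma. -/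
theorem volterra_ineq (w P ε β r : ℕ → ℂ) (B : ℕ → ℝ)
    (hw : ∀ k, w k = P k * (1 + ε k))
    (hrec : ∀ k, w (k + 2) = β (k + 1) * w (k + 1) - w k)
    (hr : ∀ k, r (k + 1) = P (k + 2) - β (k + 1) * P (k + 1) + P k)
    (hP : ∀ k, P k ≠ 0) (N : ℕ) (hN : ε N = 0) (hN1 : ε (N + 1) = 0)
    (hB : ∀ k j, k ≤ j → j < N → ‖P (j + 1) ^ 2 * ∑ i ∈ Icc k j, 1 / (P i * P (i + 1))‖ ≤ B j)
    (k : ℕ) (hk : k ≤ N) :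
    ‖ε k‖ ≤ ∑ j ∈ Ico k N, (‖r (j + 1)‖ / ‖P (j + 1)‖ * B j) * (1 + ‖ε (j + 1)‖) := by
  rw [volterra_repr w P ε β r hw hrec hr hP N hN hN1 k hk, norm_neg]
  refine (norm_sum_le _ _).trans (Finset.sum_le_sum (fun j hj => ?_))
  rw [mem_Ico] at hj
  have hPj : P (j + 1) ≠ 0 := hP (j + 1)
  have key : P (j + 1) * r (j + 1) * (1 + ε (j + 1)) * ∑ i ∈ Icc k j, 1 / (P i * P (i + 1))
      = (r (j + 1) / P (j + 1)) * (1 + ε (j + 1)) * (P (j + 1) ^ 2 * ∑ i ∈ Icc k j, 1 / (P i * P (i + 1))) := by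
    field_simp
  rw [key, norm_mul, norm_mul, norm_div]
  have h1 : ‖1 + ε (j + 1)‖ ≤ 1 + ‖ε (j + 1)‖ := by
    calc ‖1 + ε (j + 1)‖ ≤ ‖(1 : ℂ)‖ + ‖ε (j + 1)‖ := norm_add_le _ _
      _ = 1 + ‖ε (j + 1)‖ := by rw [norm_one]
  have h2 := hB k j hj.1 hj.2
  have hnn1 : 0 ≤ ‖r (j + 1)‖ / ‖P (j + 1)‖ := div_nonneg (norm_nonneg _) (norm_nonneg _)
  calc ‖r (j + 1)‖ / ‖P (j + 1)‖ * ‖1 + ε (j + 1)‖ * ‖P (j + 1) ^ 2 * ∑ i ∈ Icc k j, 1 / (P i * P (i + 1))‖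
      ≤ ‖r (j + 1)‖ / ‖P (j + 1)‖ * (1 + ‖ε (j + 1)‖) * B j := by
        gcongr
    _ = ‖r (j + 1)‖ / ‖P (j + 1)‖ * B j * (1 + ‖ε (j + 1)‖) := by ring

end Summit.AnomalousDissipation.SoloBlind.VolterraRepr
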